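/-
Copyright (c) 2026. All rights reserved.
Released under Apache 2.0 license as described in the file LICENSE.
Authors: abc-iut cell, seat abc-iut-L4-t15 (gen 6).
-/
import Literature.GroupTheory.ProcyclicModNormalOpen

/-!
# Tools for transporting the `p`-by-metacyclic profinite setting to open subgroups

Setting (cf. `Literature/GroupTheory/ProfiniteCommutatorWidthPByMetacyclic.lean`): `G` compact with
`P ⊴ G`, `t, s ∈ G`, `C := cl(⟨t⟩P)`; `(S2)`: conjugates of `t` lie in `C` and `w s w⁻¹ s⁻¹ ∈ C`;
`(S3)`: a topologically generating slot tuple with entries in `P ∪ {t, s}`.  We record: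

* `normal_topologicalClosure_zpowers_sup` — `C` is normal;
* `commutator_mem_topologicalClosure_zpowers_sup` — `⁅x, y⁆ ∈ C` for all `x, y` (`G/C` is abelian);
* `conj_and_commutator_mem_closure_of_open` — for an open `U ⊇ P` and `m` with
  `cl(⟨t⟩P) ∩ U = cl(⟨t ^ m⟩P)` (`ProcyclicModNormalOpen`): conjugates `u t^m u⁻¹` (`u ∈ U`) and all
  commutators `⁅u, v⁆` (`u, v ∈ U`) lie in `cl(⟨t ^ m⟩P)` — i.e. `(S2)` for `U` with `t_U = t ^ m` and ANY
  `s_U ∈ U`;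
* `exists_mem_subset_closure_zpowers_sup_inf` — for `C ⊴ G` with `⟨s⟩C` dense and `U ⊴ G` open, some
  `s_U ∈ U` generates `U` modulo `C ∩ U` topologically: `U ⊆ cl(⟨s_U⟩ (C ∩ U))`.

These are the group-theoretic steps of the inheritance of the setting to open subgroups (what remains
is slot bookkeeping).  Mathlib-only; no definitions, no instances (cell abc-iut, GAP-LEDGER G-L3d2g2-1).
[cite: RibesZalesskii2010, §2.7]
-/

namespace Literature.GroupTheory

open scoped commutatorElement Pointwise

variable {G : Type*} [Group G] [TopologicalSpace G] [IsTopologicalGroup G]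

/-- `C = cl(⟨t⟩P)` is normal when all conjugates of `t` lie in it. [cite: RibesZalesskii2010, §2.7] -/
theorem normal_topologicalClosure_zpowers_sup (P : Subgroup G) [hP : P.Normal] (t : G)
    (ht_conj : ∀ w : G, w * t * w⁻¹ ∈ closure ((Subgroup.zpowers t ⊔ P : Subgroup G) : Set G)) :
    ((Subgroup.zpowers t ⊔ P).topologicalClosure).Normal := by
  set C : Subgroup G := (Subgroup.zpowers t ⊔ P).topologicalClosure with hC
  have hCc : IsClosed (C : Set G) := (Subgroup.zpowers t ⊔ P).isClosed_topologicalClosure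
  refine ⟨fun c hc w => ?_⟩
  -- the set of `c` with `w c w⁻¹ ∈ C` is closed and contains `⟨t⟩P`
  have hcont : Continuous fun c : G => w * c * w⁻¹ := by continuity
  have hsub : ((Subgroup.zpowers t ⊔ P : Subgroup G) : Set G) ⊆ (fun c : G => w * c * w⁻¹) ⁻¹' (C : Set G) := by
    intro y hy
    have hy' : y ∈ ((Subgroup.zpowers t ⊔ P : Subgroup G) : Set G) := hy
    rw [Subgroup.mul_normal] at hy'
    obtain ⟨z, hz, q, hq, rfl⟩ := Set.mem_mul.mp hy'
    obtain ⟨a, rfl⟩ := Subgroup.mem_zpowers_iff.mp hz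
    change w * (t ^ a * q) * w⁻¹ ∈ C
    have h1 : w * (t ^ a * q) * w⁻¹ = (w * t * w⁻¹) ^ a * (w * q * w⁻¹) := by
      rw [conj_zpow]; group
    rw [h1]
    exact C.mul_mem (C.zpow_mem (ht_conj w) a)
      ((Subgroup.zpowers t ⊔ P).le_topologicalClosure (Subgroup.mem_sup_right (hP.conj_mem _ hq w)))
  have : closure ((Subgroup.zpowers t ⊔ P : Subgroup G) : Set G) ⊆
      (fun c : G => w * c * w⁻¹) ⁻¹' (C : Set G) := closure_minimal hsub (hCc.preimage hcont)
  exact this hc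

/-- `G/C` is abelian: `⁅x, y⁆ ∈ C = cl(⟨t⟩P)` for all `x, y`, when `G` is topologically generated by
slots in `P ∪ {t, s}` with `(S2)`. [cite: RibesZalesskii2010, §2.7] -/
theorem commutator_mem_topologicalClosure_zpowers_sup (P : Subgroup G) [hP : P.Normal] (t s : G)
    (ht_conj : ∀ w : G, w * t * w⁻¹ ∈ closure ((Subgroup.zpowers t ⊔ P : Subgroup G) : Set G))
    (hs_conj : ∀ w : G, w * s * w⁻¹ * s⁻¹ ∈ closure ((Subgroup.zpowers t ⊔ P : Subgroup G) : Set G))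
    {d : ℕ} (g : Fin d → G) (hgen : Dense ((Subgroup.closure (Set.range g) : Subgroup G) : Set G))
    (hslots : ∀ j, g j ∈ P ∨ g j = t ∨ g j = s) (x y : G) :
    ⁅x, y⁆ ∈ (Subgroup.zpowers t ⊔ P).topologicalClosure := by
  set C : Subgroup G := (Subgroup.zpowers t ⊔ P).topologicalClosure with hC
  haveI hCn : C.Normal := normal_topologicalClosure_zpowers_sup P t ht_conj
  have hCc : IsClosed (C : Set G) := (Subgroup.zpowers t ⊔ P).isClosed_topologicalClosure
  have htC : t ∈ C := (Subgroup.zpowers t ⊔ P).le_topologicalClosure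
    (Subgroup.mem_sup_left (Subgroup.mem_zpowers t))
  -- the subgroup `X = {y | ∀ x, ⁅x, y⁆ ∈ C}`
  let X : Subgroup G :=
    { carrier := {y | ∀ x : G, ⁅x, y⁆ ∈ C}
      mul_mem' := fun {a b} ha hb x => by
        rw [commutatorElement_mul_right_eq_mul_conj]
        have : ⁅x, a⁆ * a * ⁅x, b⁆ * a⁻¹ = ⁅x, a⁆ * (a * ⁅x, b⁆ * a⁻¹) := by group
        rw [this]; exact C.mul_mem (ha x) (hCn.conj_mem _ (hb x) a)
      one_mem' := fun x => by simp [C.one_mem]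
      inv_mem' := fun {a} ha x => by
        rw [commutatorElement_inv_right, ← commutatorElement_inv]
        have := hCn.conj_mem _ (C.inv_mem (ha x)) a⁻¹
        simpa using this }
  have hXc : IsClosed (X : Set G) := by
    have : (X : Set G) = ⋂ x : G, (fun y : G => ⁅x, y⁆) ⁻¹' (C : Set G) := by
      ext y; simp only [Set.mem_iInter, Set.mem_preimage, SetLike.mem_coe]; rfl
    rw [this]
    refine isClosed_iInter fun x => hCc.preimage ?_
    simp only [commutatorElement_def]
    exact ((continuous_const.mul continuous_id).mul continuous_const).mul continuous_inv
  have hgX : Set.range g ⊆ (X : Set G) := by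
    rintro _ ⟨j, rfl⟩ x
    rcases hslots j with h | h | h
    · -- `⁅x, p⁆ ∈ P ≤ C`
      have : ⁅x, g j⁆ ∈ P := by
        rw [commutatorElement_def]
        have h1 : x * g j * x⁻¹ * (g j)⁻¹ = (x * g j * x⁻¹) * (g j)⁻¹ := rfl
        rw [h1]; exact P.mul_mem (hP.conj_mem _ h x) (P.inv_mem h)
      exact (Subgroup.zpowers t ⊔ P).le_topologicalClosure (Subgroup.mem_sup_right this)
    · rw [h, commutatorElement_def]
      exact C.mul_mem (ht_conj x) (C.inv_mem htC)
    · rw [h, commutatorElement_def]; exact hs_conj x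
  have hXtop : (X : Set G) = Set.univ := by
    have h1 : ((Subgroup.closure (Set.range g) : Subgroup G) : Set G) ⊆ X := fun z hz =>
      (Subgroup.closure_le X).mpr hgX hz
    exact Set.eq_univ_of_univ_subset ((hgen.closure_eq ▸ closure_minimal h1 hXc))
  have : y ∈ (X : Set G) := by rw [hXtop]; exact Set.mem_univ y
  exact this x

/-- **`(S2)` for an open subgroup.**  Let `U ⊴ G` be open normal with `P ≤ U` and let `m` satisfy
`cl(⟨t⟩P) ∩ U = cl(⟨t^m⟩P)` (from `exists_pow_mem_closure_inter_eq`).  If `C = cl(⟨t⟩P)` is normal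
with `G/C` abelian, then for `u, v ∈ U`: the conjugate `u t^m u⁻¹` and the commutator `⁅u, v⁆` lie in
`cl(⟨t^m⟩P)`. [cite: RibesZalesskii2010, §2.7] -/
theorem conj_and_commutator_mem_closure_of_open (P : Subgroup G) (t : G)
    (hCn : ((Subgroup.zpowers t ⊔ P).topologicalClosure).Normal)
    (hcomm : ∀ x y : G, ⁅x, y⁆ ∈ (Subgroup.zpowers t ⊔ P).topologicalClosure)
    (U : Subgroup G) {m : ℕ} (htm : t ^ m ∈ U)
    (heq : closure ((Subgroup.zpowers t ⊔ P : Subgroup G) : Set G) ∩ (U : Set G) =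
      closure ((Subgroup.zpowers (t ^ m) ⊔ P : Subgroup G) : Set G)) :
    (∀ u ∈ U, u * t ^ m * u⁻¹ ∈ closure ((Subgroup.zpowers (t ^ m) ⊔ P : Subgroup G) : Set G)) ∧
    (∀ u ∈ U, ∀ v ∈ U, ⁅u, v⁆ ∈ closure ((Subgroup.zpowers (t ^ m) ⊔ P : Subgroup G) : Set G)) := by
  set C : Subgroup G := (Subgroup.zpowers t ⊔ P).topologicalClosure with hC
  have hCeq : (C : Set G) = closure ((Subgroup.zpowers t ⊔ P : Subgroup G) : Set G) := rfl
  have htmC : t ^ m ∈ C := (Subgroup.zpowers t ⊔ P).le_topologicalClosure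
    (Subgroup.mem_sup_left (Subgroup.pow_mem _ (Subgroup.mem_zpowers t) m))
  constructor
  · intro u hu
    rw [← heq]
    exact ⟨hCn.conj_mem _ htmC u, U.mul_mem (U.mul_mem hu htm) (U.inv_mem hu)⟩
  · intro u hu v hv
    rw [← heq]
    refine ⟨hcomm u v, ?_⟩
    rw [commutatorElement_def]
    exact U.mul_mem (U.mul_mem (U.mul_mem hu hv) (U.inv_mem hu)) (U.inv_mem hv)

variable [CompactSpace G] [TotallyDisconnectedSpace G]

/-- **A topological generator of `U` modulo `C ∩ U`.**  Let `C ⊴ G` and `s ∈ G` with `⟨s⟩ C` dense in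
`G`, and let `U ⊴ G` be open normal.  Then some `s_U ∈ U` generates `U` modulo `C ∩ U` topologically:
`U ⊆ cl(⟨s_U⟩ (C ⊓ U))`. [cite: RibesZalesskii2010, §2.7] -/
theorem exists_mem_subset_closure_zpowers_sup_inf (C : Subgroup G) [hCn : C.Normal]
    (s : G) (hdense : Dense (((Subgroup.zpowers s ⊔ C : Subgroup G)) : Set G))
    (U : Subgroup G) [hU : U.Normal] (hUo : IsOpen (U : Set G)) :
    ∃ sU ∈ U, (U : Set G) ⊆ closure ((Subgroup.zpowers sU ⊔ (C ⊓ U) : Subgroup G) : Set G) := by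
  haveI : (C ⊔ U).Normal := Subgroup.sup_normal C U
  have hUCo : IsOpen ((C ⊔ U : Subgroup G) : Set G) :=
    Subgroup.isOpen_mono (le_sup_right : U ≤ C ⊔ U) hUo
  obtain ⟨m', -, hsm', heq⟩ := exists_pow_mem_closure_inter_eq C s (C ⊔ U) hUCo le_sup_left
  rw [hdense.closure_eq, Set.univ_inter] at heq
  -- `s ^ m' = c₀ * u₀` with `c₀ ∈ C`, `u₀ ∈ U`
  have hsm'' : s ^ m' ∈ ((C ⊔ U : Subgroup G) : Set G) := hsm'
  rw [Subgroup.normal_mul] at hsm''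
  obtain ⟨c₀, hc₀, u₀, hu₀, hcu⟩ := Set.mem_mul.mp hsm''
  refine ⟨u₀, hu₀, ?_⟩
  -- `⟨s ^ m'⟩ ⊔ C = ⟨u₀⟩ ⊔ C`
  have hsub : Subgroup.zpowers (s ^ m') ⊔ C = Subgroup.zpowers u₀ ⊔ C := by
    apply le_antisymm
    · refine sup_le ?_ le_sup_right
      rw [Subgroup.zpowers_le, ← hcu]
      exact Subgroup.mul_mem _ (Subgroup.mem_sup_right hc₀)
        (Subgroup.mem_sup_left (Subgroup.mem_zpowers u₀))
    · refine sup_le ?_ le_sup_right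
      rw [Subgroup.zpowers_le]
      have : u₀ = c₀⁻¹ * s ^ m' := by rw [← hcu]; group
      rw [this]
      exact Subgroup.mul_mem _ (Subgroup.mem_sup_right (C.inv_mem hc₀))
        (Subgroup.mem_sup_left (Subgroup.mem_zpowers _))
  rw [hsub] at heq
  -- `x ∈ U` lies in `(⟨u₀⟩ ⊔ (C ⊓ U)) * N` for every open normal `N`
  intro x hxU
  rw [closure_eq_iInter_mul_openNormalSubgroup]
  refine Set.mem_iInter.mpr fun N => ?_
  obtain ⟨Wn, hWn⟩ := ProfiniteGrp.exist_openNormalSubgroup_sub_open_nhds_of_one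
    (hUo.inter N.isOpen') (⟨U.one_mem, (N : Subgroup G).one_mem⟩ : (1 : G) ∈ (U : Set G) ∩ _)
  have hx : x ∈ closure ((Subgroup.zpowers u₀ ⊔ C : Subgroup G) : Set G) := by
    rw [← heq]; exact Subgroup.mem_sup_right hxU
  obtain ⟨y, hy, w, hw, rfl⟩ := Set.mem_mul.mp
    (closure_subset_mul_of_isOpen _ (Wn : Subgroup G) Wn.isOpen' hx)
  have hy' : y ∈ ((Subgroup.zpowers u₀ ⊔ C : Subgroup G) : Set G) := hy
  rw [Subgroup.mul_normal] at hy'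
  obtain ⟨z, hz, c, hc, rfl⟩ := Set.mem_mul.mp hy'
  have hwU : w ∈ U := (hWn hw).1
  have hzU : z ∈ U := by
    obtain ⟨a, rfl⟩ := Subgroup.mem_zpowers_iff.mp hz
    exact U.zpow_mem hu₀ a
  have hcU : c ∈ U := by
    have : c = z⁻¹ * (z * c * w) * w⁻¹ := by group
    rw [this]; exact U.mul_mem (U.mul_mem (U.inv_mem hzU) hxU) (U.inv_mem hwU)
  refine Set.mem_mul.mpr ⟨z * c, ?_, w, (hWn hw).2, rfl⟩
  exact Subgroup.mul_mem _ (Subgroup.mem_sup_left hz) (Subgroup.mem_sup_right ⟨hc, hcU⟩)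

end Literature.GroupTheory
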